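import Summits.BirchSwinnertonDyer.BirchSwinnertonDyer.Theorems.GenusKolyvaginAtTwoPowDvdShaCardAtTwoRTBottomRungClosure
import Summits.BirchSwinnertonDyer.BirchSwinnertonDyer.Theorems.GenusKolyvaginAtTwoPowDvdShaCardAtTwoRTGenusKernelHabitat
import Summits.BirchSwinnertonDyer.BirchSwinnertonDyer.Theorems.GenusKolyvaginAtTwoPowDvdShaCardAtTwoRTKolyvaginClassOrderGeneral
import Summits.BirchSwinnertonDyer.BirchSwinnertonDyer.Theorems.KolyvaginRoadThreeLevelData
import HarnessLib

/-!
# Route `GenusKolyvaginAtTwo`, crux L_T `PowDvdShaCardAtTwoRT` (stmt-BirchSwinnertonDyer-23242), LINE 18 stub KS, bottom rung: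
# REMOVING THE PARITY — append ONE deep prime to a level-4 Gross witness keeping 2-primitivity (Čebotarev at level `2^L`)

LEAD seat `bsd-line-gk2-p1` g17 (cell `bsd-f1-sign2`), `--supports 23242 --as helper`.  THEOREMS ONLY; no `sorry`; standard axioms.
BSD is NOT proved by any of this; neither is the crux, nor stub KS, nor stub L.

WHY.  `exists_deep_primitive_of_gross_witness` (`…RTBottomRungClosure`) needs the parity `−w(E)(−1)^{ω(n₀)+1} = 1` of the witness so that the
swapped classes are `τ`-fixed and descend to `E` over `ℚ`.  The other parity is reduced to this one by appending ONE deep Kolyvagin prime to the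
witness WITHOUT losing primitivity: Čebotarev at level `2^L` for the level-raised class `ι c₂(n₀)` (signed Q5R, one eigenclass; `hres` from
(NPh_L^{2N})) gives a deep `ℓ` with `2•c₂(n₀) ∉ tors_λ`, and Q2 transports it to `2•c₂(n₀ℓ) ∉ tors_λ`, so `c₂(n₀ℓ)` has order `4` (McCallum Cor. 4.5 /
p. 285).  Then the bottom rung holds for EVERY witness parity, with `R ∈ {ω(n₀), ω(n₀)+1}`.
* `exists_deep_mul_primitive` — append a deep prime keeping `addOrderOf c₂ = 4`;
* **`exists_deep_primitive_of_gross_witness'`** — THE BOTTOM RUNG without the parity hypothesis;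
* §4 `exists_deep_notTwoDvd_of_gross_witness` — the same bottom rung in the crux's own currency «`P(n) ∉ 2E(K[n])` in / out» (the `r = R` clause
  of gk2-p2's (P52÷)), via the single-datum conversions `not_two_dvd_derivedPoint_of_addOrderOf_kolyvaginClass_two_pow` /
  `addOrderOf_kolyvaginClass_two_eq_pow_of_not_two_dvd_single` and the family `exists_family_eq_of_isKolyvaginPrime`;
* `addOrderOf_kolyvaginClass_two_pow_eq_of_four` — single-datum level conversion «`ord c₂(e) = 4 ⟹ ord c_L(e) = 2^L`» (McCallum Cor. 4.5 both ways),
  and `exists_deep_primitive_of_gross_witness_pow` — the bottom rung in the currency of `exists_kolyvaginMinima`'s socket (`ord c_L = 2^L`).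
Namespace `…Theorems.GenusExact.RelaxedCount`.  Closes nothing.  BSD is NOT proved by any of this.

References: [McCallumLMS1991] §5 p. 285, Cor. 4.5, §3 Cor. 3.2; [GrossLMS1991] §3 (3.3), Prop. 5.4, 6.2; [Kolyvagin1991MathAnn] Thm. 2.2.
-/

set_option autoImplicit false
-- the Theorems namespace of this sub repeats the summit name by design (D-0017 nested layout)
set_option linter.dupNamespace false

noncomputable section

open scoped Classical

open Field NumberField IsDedekindDomain Function WeierstrassCurve Rat.HeightOneSpectrum
open Literature.NumberTheory.EllipticCurves
open Literature.NumberTheory.GaloisRepresentations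
open Literature.NumberTheory.GaloisCohomology
open Summit.BirchSwinnertonDyer.BirchSwinnertonDyer.Theses.GenusKolyvaginAtTwo (KolyvaginRelationAtTwo)
open Summit.BirchSwinnertonDyer.Rank1Residual (X11b.KolyvaginAssembly.discr_lt_neg_four JET.exists_compatible_data_of_grossCM)
open Summit.BirchSwinnertonDyer.BirchSwinnertonDyer.Theorems.GenusExact.VisiblePairAtTwo
  (natCast_mem_primesEquiv_symm natGenerator_eq_of_natCast_prime_mem natCast_prime_mem_iff_eq exists_natCast_mem
    torsionBy_two_eq_bot_of_surj torsionH1OfDvd_mem_torsionLocalKer)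

namespace Summit.BirchSwinnertonDyer.BirchSwinnertonDyer.Theorems.GenusExact.RelaxedCount

variable (W : WeierstrassCurve ℚ) [W.IsElliptic] [W.IsGloballyMinimal] [NeZero (W.conductorNorm ℤ)]
  {K : Type} [Field K] [NumberField K]

/-- **Append a deep prime keeping primitivity.**  Frame of L_T with Q2 and (NPh_L^{2N}) (`L ≥ 2`); `n` a square-free product of level-4
Gross–Kolyvagin primes with a datum `e`, `addOrderOf c₂(e) = 4`.  THEN there are a Zhang–Kolyvagin prime `ℓ ∤ n` of index `≥ L` with
`Frob = Frob_∞` on `K(E[2^L])` and a datum `e′` at `nℓ` with `addOrderOf c₂(e′) = 4`. [cite: McCallumLMS1991, §5 p. 285; §4 Cor. 4.5; §3 Cor. 3.2] -/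
theorem exists_deep_mul_primitive (hQ2 : KolyvaginRelationAtTwo) (hcm : ¬ W.HasCM) (hΔ : W.Δ < 0) (hT : Odd W.tamagawaProduct)
    (hρ : ∀ m : ℕ, W.HasSurjectiveModNGaloisRep (2 ^ m : ℕ))
    (hK : IsImaginaryQuadratic K) (hodd : Odd (NumberField.discr K)) (h3 : NumberField.discr K ≠ -3)
    (hHe : SatisfiesHeegnerHypothesis (W.conductorNorm ℤ) K) (hns : ¬ IsSquare ((NumberField.discr K : ℚ) * -|W.Δ|))
    (c : K ≃ₐ[ℚ] K) (hc : c ≠ 1)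
    (Dt : ModularForms.ModularParametrizationData W (W.conductorNorm ℤ)) (β : ℤ) (ι : K →+* ℂ) {L : ℕ} (hL2 : 2 ≤ L)
    (hNPh : ∀ z : galH1Torsion (W.baseChange K) ((2 ^ L : ℕ) : ℤ),
      (∀ ρ' ∈ torsionFixing (W.baseChange K) ((2 ^ L : ℕ) : ℤ), h1Eval (W.baseChange K) ((2 ^ L : ℕ) : ℤ) z ρ' = 0) →
      (∀ w : HeightOneSpectrum (𝓞 K), ((2 * W.conductorNorm ℤ : ℕ) : 𝓞 K) ∈ w.asIdeal →
        z ∈ selmerLocalKer (W.baseChange K) (w.adicCompletion K) ((2 ^ L : ℕ) : ℤ)) → z = 0)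
    {n : ℕ} (hn : Squarefree n)
    (hnK : ∀ q ∈ n.primeFactors, Zhang2014.IsKolyvaginPrime (W.conductorNorm ℤ) W K 2 q ∧ 2 ≤ Zhang2014.kolyvaginIndex W 2 q)
    (e : KolyvaginHeegnerData Dt β ι n) (he : addOrderOf (e.kolyvaginClass Nat.prime_two 2) = 2 ^ 2) :
    ∃ (ℓ : ℕ) (e' : KolyvaginHeegnerData Dt β ι (n * ℓ)), ℓ.Prime ∧ ℓ ∉ n.primeFactors ∧
      Zhang2014.IsKolyvaginPrime (W.conductorNorm ℤ) W K 2 ℓ ∧ L ≤ Zhang2014.kolyvaginIndex W 2 ℓ ∧ FrobEqFrobInfty W K (2 ^ L) ℓ ∧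
      addOrderOf (e'.kolyvaginClass Nat.prime_two 2) = 2 ^ 2 := by
  haveI : Fact (Nat.Prime 2) := ⟨Nat.prime_two⟩
  have hn0 : n ≠ 0 := hn.ne_zero
  have h2K : Module.finrank ℚ K = 2 := hK.1
  have h4 : NumberField.discr K ≠ -4 := fun h ↦ by
    rw [h] at hodd
    exact (Int.not_even_iff_odd.mpr hodd) ⟨-2, by norm_num⟩
  have hD : NumberField.discr K < -4 := X11b.KolyvaginAssembly.discr_lt_neg_four hK ⟨h3, h4⟩
  have hρ2 : W.HasSurjectiveModNGaloisRep 2 := by simpa using hρ 1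
  have hsurj1 : W.HasSurjectiveModNGaloisRep ((2 : ℤ) ^ 1) := by exact_mod_cast hρ 1
  have hL1 : 1 ≤ L := by omega
  have h12 : (1 : ℕ) ≤ 2 := by norm_num
  have h4L : ((2 ^ 2 : ℕ) : ℤ) ∣ ((2 ^ L : ℕ) : ℤ) := by
    obtain ⟨k, hk⟩ := Nat.exists_eq_add_of_le hL2
    exact ⟨((2 ^ k : ℕ) : ℤ), by rw [hk, pow_add]; push_cast; ring⟩
  -- `ι : H¹(K, E[4]) → H¹(K, E[2^L])` is injective
  have hbotK : AddSubgroup.torsionBy (W.baseChange K).toAffine.Point ((2 : ℕ) : ℤ) = ⊥ := by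
    rw [eq_bot_iff]
    intro P hP
    rw [AddSubgroup.mem_bot]
    have hP' : 2 • P = 0 := by
      have h := (mem_torsionBy_iff.mp hP : ((2 : ℕ) : ℤ) • P = 0)
      rwa [natCast_zsmul] at h
    exact forall_two_nsmul_baseChange_of_hasSurjectiveModNGaloisRep_two_of_isImaginaryQuadratic W hρ2 K hK P hP'
  have hιinj : Injective (torsionH1OfDvd (W.baseChange K) h4L) :=
    Summit.BirchSwinnertonDyer.BirchSwinnertonDyer.Theorems.GenusExact.VisiblePairAtTwo.torsionH1OfDvd_pow_injective
      (W.baseChange K) (p := 2) hbotK h4L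
  set cK := e.kolyvaginClass Nat.prime_two 2 with hcK_def
  set X := torsionH1OfDvd (W.baseChange K) h4L cK with hX_def
  have hXord : addOrderOf X = 2 ^ 2 := by rw [hX_def, addOrderOf_injective _ hιinj, he]
  have hX0 : X ≠ 0 := PlusDescent.ne_zero_of_addOrderOf_eq_two_pow (by norm_num) hXord
  -- sign of `X`
  obtain ⟨hsgn, hτ⟩ := KolyvaginClassSign.sign_conjAct_kolyvaginClass_two hK h3 h4 hodd hHe hsurj1 c hc Dt β ι hn h12 hnK e
  have hτX : conjAct W c ((2 ^ L : ℕ) : ℤ) X = (-W.rootNumber * (-1) ^ n.primeFactors.card) • X := by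
    rw [hX_def, conjAct_torsionH1OfDvd, hτ, map_zsmul]
  -- `X` is Selmer at the places over `2N`
  have hsel2N : ∀ w : HeightOneSpectrum (𝓞 K), ((2 * W.conductorNorm ℤ : ℕ) : 𝓞 K) ∈ w.asIdeal →
      X ∈ selmerLocalKer (W.baseChange K) (w.adicCompletion K) ((2 ^ L : ℕ) : ℤ) := by
    intro w hw
    refine (torsionH1OfDvd_mem_selmerLocalKer_iff_mem (W.baseChange K) h4L (w.adicCompletion K) cK).mpr
      (RankOneAtTwoOneDoor.kolyvaginClass_two_mem_selmerLocalKer_of_odd_tamagawaProduct W hρ hT K hK h3 h4 hHe Dt β ι 2 hn hnK e w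
        (natCast_notMem_of_forall_primeFactors (K := K) hn w fun q hq hqw ↦ ?_))
    -- a prime `q ∣ n` in `w` together with `2N ∈ w`: `q ∣ 2N`, impossible
    have hqp : q.Prime := Nat.prime_of_mem_primeFactors hq
    have hunder : ∀ m : ℕ, (m : 𝓞 K) ∈ w.asIdeal → (m : 𝓞 ℚ) ∈ (w.under (𝓞 ℚ)).asIdeal := fun m hm ↦ by
      change (m : 𝓞 ℚ) ∈ w.asIdeal.under (𝓞 ℚ)
      rw [Ideal.under_def, Ideal.mem_comap, map_natCast]
      exact hm
    have hgen : natGenerator (w.under (𝓞 ℚ)) = q := natGenerator_eq_of_natCast_prime_mem hqp (hunder q hqw)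
    have hdvd := (Rat.natCast_mem_asIdeal_iff (w.under (𝓞 ℚ))).mp (hunder _ hw)
    rw [hgen] at hdvd
    rcases (Nat.Prime.dvd_mul hqp).mp hdvd with h2 | hN
    · exact (hnK q hq).1.2.2.2.1 ((Nat.prime_dvd_prime_iff_eq hqp Nat.prime_two).mp h2)
    · exact (hnK q hq).1.2.1 hN
  -- Q5R's `hres` for the singleton, from (NPh_L^{2N})
  have hres : ∀ a : Fin 1 → ℤ, (∀ ρ' ∈ torsionFixing (W.baseChange K) ((2 ^ L : ℕ) : ℤ),
      h1Eval (W.baseChange K) ((2 ^ L : ℕ) : ℤ) (∑ i, a i • (![X] : Fin 1 → _) i) ρ' = 0) → ∑ i, a i • (![X] : Fin 1 → _) i = 0 := by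
    intro a ha
    refine hNPh _ ha fun w hw ↦ ?_
    simp only [Fin.sum_univ_one, Fin.isValue, Matrix.cons_val_zero]
    exact AddSubgroup.zsmul_mem _ (hsel2N w hw) _
  have hinf := equivariantChebotarevAtTwo_eigen_of_not_isSquare (W.conductorNorm ℤ) W hcm hΔ K hK hns hρ c hc L hL1 1 ![X]
    ![-W.rootNumber * (-1) ^ n.primeFactors.card]
    (fun i ↦ by fin_cases i; exact hsgn) (fun i ↦ by fin_cases i; exact hX0) (fun i ↦ by fin_cases i; exact hτX)
    (fun a ha i ↦ by
      fin_cases i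
      simp only [Fin.sum_univ_one, Fin.isValue, Matrix.cons_val_zero] at ha
      show ((addOrderOf X : ℕ) : ℤ) ∣ a 0
      rw [addOrderOf_dvd_iff_zsmul_eq_zero]
      exact ha)
    hres ![2] (fun i ↦ by fin_cases i; exact hXord) ![2] (fun i ↦ by fin_cases i; exact le_rfl)
  obtain ⟨ℓ, hℓmem, hℓn⟩ := hinf.exists_notMem_finset n.primeFactors
  obtain ⟨hFrob, hKol, hidx, hloc⟩ := hℓmem
  have hℓp : ℓ.Prime := hKol.1
  have hℓdvd : ¬ ℓ ∣ n := fun h ↦ hℓn (Nat.mem_primeFactors.mpr ⟨hℓp, h, hn0⟩)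
  have hsq : Squarefree (n * ℓ) :=
    (Nat.squarefree_mul ((Nat.Prime.coprime_iff_not_dvd hℓp).mpr hℓdvd).symm).mpr ⟨hn, hℓp.squarefree⟩
  have hall : ∀ q ∈ (n * ℓ).primeFactors, Zhang2014.IsKolyvaginPrime (W.conductorNorm ℤ) W K 2 q ∧ 2 ≤ Zhang2014.kolyvaginIndex W 2 q := by
    intro q hq
    rw [Nat.primeFactors_mul hn0 hℓp.ne_zero, Finset.mem_union] at hq
    rcases hq with hq | hq
    · exact hnK q hq
    · rw [hℓp.primeFactors, Finset.mem_singleton] at hq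
      subst hq
      exact ⟨hKol, hL2.trans hidx⟩
  -- a compatible datum at `nℓ`
  obtain ⟨dℓ, hdℓ⟩ := JET.exists_compatible_data_of_grossCM
    (phi_heegnerPointOfConductor_mem_range_map_ringClassField_holds (W.conductorNorm ℤ) W K) hK hD hHe 2 Dt β ι hn
    (fun q hq ↦ (hnK q hq).1) e
  obtain ⟨hσc, hS, hS', hemb⟩ := hdℓ ℓ hKol hℓn
  set e' := dℓ ℓ hKol hℓn with he'_def
  obtain ⟨v, hv⟩ := exists_natCast_mem (K := K) hℓp
  -- `2•X ∉ tors_v`, hence `2•cK ∉ tors_v` (ι preserves the strict local kernel)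
  have hX2 : ¬ ((2 ^ 1 : ℕ) : ℤ) • cK ∈ (W.baseChange K).torsionLocalKer (v.adicCompletion K) ((2 ^ 2 : ℕ) : ℤ) := by
    intro h
    have h' := torsionH1OfDvd_mem_torsionLocalKer (W.baseChange K) (v.adicCompletion K) h4L h
    rw [map_zsmul] at h'
    have := (by simpa using hloc 0 v hv 1 : ((2 ^ 1 : ℕ) : ℤ) • X ∈ _ ↔ 2 ≤ 1).mp h'
    omega
  -- Q2 at `v`: `2•c₂(e′) ∉ tors_v`, so `c₂(e′)` has order `4`
  have hQ := hQ2 W hcm K hK h3 h4 hHe hρ Dt β ι 2 h12 n ℓ hsq hℓp hℓdvd hall e e' hσc hS hS' hemb v hv 1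
  have he'2 : ((2 ^ 1 : ℕ) : ℤ) • e'.kolyvaginClass Nat.prime_two 2 ≠ 0 := fun h0 ↦
    hX2 (hQ.2.mp (by rw [h0]; exact AddSubgroup.zero_mem _))
  refine ⟨ℓ, e', hℓp, hℓn, hKol, hidx, hFrob, addOrderOf_eq_prime_pow (n := 1) ?_ ?_⟩
  · intro h
    apply he'2
    rw [natCast_zsmul]
    exact h
  · have h : (((2 ^ 2 : ℕ) : ℤ)) • e'.kolyvaginClass Nat.prime_two 2 = 0 := zsmul_discreteH1_torsion _ _
    rw [natCast_zsmul] at h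
    exact h

/-- **THE BOTTOM RUNG, no parity hypothesis.**  As `exists_deep_primitive_of_gross_witness`, without the parity of `ω(n₀)`: the all-deep primitive
product has `ω(n) ∈ {ω(n₀), ω(n₀)+1}`. [cite: McCallumLMS1991, §5 proof of Prop. 5.2, p. 285] [cite: Kolyvagin1991MathAnn, Thm. 2.2] -/
theorem exists_deep_primitive_of_gross_witness' (hQ2 : KolyvaginRelationAtTwo) (hcm : ¬ W.HasCM) (hΔ : W.Δ < 0)
    (hT : Odd W.tamagawaProduct) (hρ : ∀ m : ℕ, W.HasSurjectiveModNGaloisRep (2 ^ m : ℕ))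
    (hK : IsImaginaryQuadratic K) (hodd : Odd (NumberField.discr K)) (h3 : NumberField.discr K ≠ -3)
    (hHe : SatisfiesHeegnerHypothesis (W.conductorNorm ℤ) K) (hns : ¬ IsSquare ((NumberField.discr K : ℚ) * -|W.Δ|))
    (Dt : ModularForms.ModularParametrizationData W (W.conductorNorm ℤ)) (β : ℤ) (ι : K →+* ℂ) {L : ℕ} (hL2 : 2 ≤ L)
    (hNPh : ∀ z : galH1Torsion (W.baseChange K) ((2 ^ L : ℕ) : ℤ),
      (∀ ρ' ∈ torsionFixing (W.baseChange K) ((2 ^ L : ℕ) : ℤ), h1Eval (W.baseChange K) ((2 ^ L : ℕ) : ℤ) z ρ' = 0) →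
      (∀ w : HeightOneSpectrum (𝓞 K), ((2 * W.conductorNorm ℤ : ℕ) : 𝓞 K) ∈ w.asIdeal →
        z ∈ selmerLocalKer (W.baseChange K) (w.adicCompletion K) ((2 ^ L : ℕ) : ℤ)) → z = 0)
    (hTr : ∀ (n' : ℕ) (d' : KolyvaginHeegnerData Dt β ι n') (Z : galoisCohomology (W.torsionGaloisModule ((2 ^ 2 : ℕ) : ℤ)) 1),
      Squarefree n' →
      (∀ q ∈ n'.primeFactors, Zhang2014.IsKolyvaginPrime (W.conductorNorm ℤ) W K 2 q ∧ 2 ≤ Zhang2014.kolyvaginIndex W 2 q ∧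
        FrobEqFrobInfty W K (2 ^ 2) q) →
      resTorsion W K ((2 ^ 2 : ℕ) : ℤ) Z = d'.kolyvaginClass Nat.prime_two 2 →
      ∀ (v : HeightOneSpectrum (𝓞 ℚ)) (ℓ : ℕ), ℓ ∈ n'.primeFactors → (ℓ : 𝓞 ℚ) ∈ v.asIdeal →
        L ≤ Zhang2014.kolyvaginIndex W 2 ℓ → FrobEqFrobInfty W K (2 ^ L) ℓ →
        ∀ 𝔓 ∈ v.primesAbove, ∀ F c₀ : absoluteGaloisGroup ℚ, IsArithFrobAt (𝓞 ℚ) F 𝔓 →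
          IsComplexConjugation (Rat.castHom ℝ) c₀ → (∀ P : geomTorsion W ((2 ^ 2 : ℕ) : ℤ), F • P = c₀ • P) →
          ∃ P₁ : geomTorsion W ((2 ^ 2 : ℕ) : ℤ), h1Eval W _ ((2 : ℕ) • Z) F = F • P₁ - P₁)
    {n₀ : ℕ} (hn₀ : Squarefree n₀)
    (hn₀K : ∀ q ∈ n₀.primeFactors, Zhang2014.IsKolyvaginPrime (W.conductorNorm ℤ) W K 2 q ∧ 2 ≤ Zhang2014.kolyvaginIndex W 2 q ∧
      FrobEqFrobInfty W K (2 ^ 2) q)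
    (e₀ : KolyvaginHeegnerData Dt β ι n₀) (he₀ : addOrderOf (e₀.kolyvaginClass Nat.prime_two 2) = 2 ^ 2) :
    ∃ (n : ℕ) (e : KolyvaginHeegnerData Dt β ι n), Squarefree n ∧
      (n.primeFactors.card = n₀.primeFactors.card ∨ n.primeFactors.card = n₀.primeFactors.card + 1) ∧
      (∀ q ∈ n.primeFactors, Zhang2014.IsKolyvaginPrime (W.conductorNorm ℤ) W K 2 q ∧ L ≤ Zhang2014.kolyvaginIndex W 2 q ∧
        FrobEqFrobInfty W K (2 ^ L) q) ∧
      addOrderOf (e.kolyvaginClass Nat.prime_two 2) = 2 ^ 2 := by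
  have h2K : Module.finrank ℚ K = 2 := hK.1
  -- the sign `−w(E)(−1)^{ω+1}` is `±1`
  have hw : W.rootNumber = 1 ∨ W.rootNumber = -1 := W.rootNumber_eq_one_or
  by_cases hpar : -W.rootNumber * (-1) ^ (n₀.primeFactors.card + 1) = 1
  · obtain ⟨n, e, hn, hcard, hK', he⟩ := exists_deep_primitive_of_gross_witness W hQ2 hcm hΔ hT hρ hK hodd h3 hHe hns Dt β ι hL2 hNPh hTr
      hn₀ hn₀K e₀ he₀ hpar
    exact ⟨n, e, hn, Or.inl hcard, hK', he⟩
  · -- append one deep prime to flip the parity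
    obtain ⟨τ, -, hτ, -⟩ := PlusDescent.exists_gal_ne_one_sqrt_discr (K := K) h2K
    obtain ⟨ℓ, e₁, hℓp, hℓn, hKol, hidx, hFrob, he₁⟩ := exists_deep_mul_primitive W hQ2 hcm hΔ hT hρ hK hodd h3 hHe hns τ hτ Dt β ι hL2
      hNPh hn₀ (fun q hq ↦ ⟨(hn₀K q hq).1, (hn₀K q hq).2.1⟩) e₀ he₀
    have hn0 : n₀ ≠ 0 := hn₀.ne_zero
    have hℓdvd : ¬ ℓ ∣ n₀ := fun h ↦ hℓn (Nat.mem_primeFactors.mpr ⟨hℓp, h, hn0⟩)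
    have hsq : Squarefree (n₀ * ℓ) :=
      (Nat.squarefree_mul ((Nat.Prime.coprime_iff_not_dvd hℓp).mpr hℓdvd).symm).mpr ⟨hn₀, hℓp.squarefree⟩
    have hpf : (n₀ * ℓ).primeFactors = insert ℓ n₀.primeFactors := by
      rw [Nat.primeFactors_mul hn0 hℓp.ne_zero, hℓp.primeFactors, Finset.union_comm]; rfl
    have hcard : (n₀ * ℓ).primeFactors.card = n₀.primeFactors.card + 1 := by rw [hpf, Finset.card_insert_of_notMem hℓn]
    have hK' : ∀ q ∈ (n₀ * ℓ).primeFactors, Zhang2014.IsKolyvaginPrime (W.conductorNorm ℤ) W K 2 q ∧ 2 ≤ Zhang2014.kolyvaginIndex W 2 q ∧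
        FrobEqFrobInfty W K (2 ^ 2) q := by
      intro q hq
      rw [hpf, Finset.mem_insert] at hq
      rcases hq with rfl | hq
      · exact ⟨hKol, hL2.trans hidx, hFrob.of_dvd (pow_dvd_pow 2 hL2)⟩
      · exact hn₀K q hq
    have hpm : -W.rootNumber * (-1) ^ (n₀.primeFactors.card + 1) = 1 ∨
        -W.rootNumber * (-1) ^ (n₀.primeFactors.card + 1) = -1 := by
      rcases hw with h | h <;> rcases neg_one_pow_eq_or ℤ (n₀.primeFactors.card + 1) with h1 | h1 <;> rw [h, h1] <;> norm_num
    have hm1 : -W.rootNumber * (-1) ^ (n₀.primeFactors.card + 1) = -1 := hpm.resolve_left hpar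
    have hpar' : -W.rootNumber * (-1) ^ ((n₀ * ℓ).primeFactors.card + 1) = 1 := by
      rw [hcard, pow_succ, ← mul_assoc, hm1]; norm_num
    obtain ⟨n, e, hn, hcardn, hKn, he⟩ := exists_deep_primitive_of_gross_witness W hQ2 hcm hΔ hT hρ hK hodd h3 hHe hns Dt β ι hL2 hNPh hTr
      hsq hK' e₁ he₁ hpar'
    exact ⟨n, e, hn, Or.inr (by rw [hcardn, hcard]), hKn, he⟩

/-! ## §3 The level conversion and the socket form -/

/-- A family of Kolyvagin–Heegner data at every divisor of a square-free product `n` of Zhang–Kolyvagin primes, EQUAL to a given datum `e` at `n`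
(Gross's CM data at the other divisors).  The tree's order / divisibility formulas are stated for such families. -/
theorem exists_family_eq_of_isKolyvaginPrime (hK : IsImaginaryQuadratic K) (hHe : SatisfiesHeegnerHypothesis (W.conductorNorm ℤ) K)
    (Dt : ModularForms.ModularParametrizationData W (W.conductorNorm ℤ)) (β : ℤ) (ι : K →+* ℂ) {n : ℕ} (hn : Squarefree n)
    (hnK : ∀ q ∈ n.primeFactors, Zhang2014.IsKolyvaginPrime (W.conductorNorm ℤ) W K 2 q) (e : KolyvaginHeegnerData Dt β ι n) :
    ∃ fam : (m : ℕ) → m ∣ n → KolyvaginHeegnerData Dt β ι m, fam n dvd_rfl = e := by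
  have hdata : ∀ m, m ∣ n → Nonempty (KolyvaginHeegnerData Dt β ι m) := fun m hm ↦
    BirchSwinnertonDyer.Theorems.nonempty_kolyvaginHeegnerData_of_grossCM
      (phi_heegnerPointOfConductor_mem_range_map_ringClassField_holds (W.conductorNorm ℤ) W K)
      (exists_generator_ringClassGalOver_holds (K := K)) hK hHe Dt β ι e.dvd_sq_sub (hn.squarefree_of_dvd hm)
      (fun q hq ↦ (hnK q (Nat.primeFactors_mono hm hn.ne_zero hq)).2.2.2.2.1)
  refine ⟨fun m hm ↦ if h : m = n then h ▸ e else Classical.choice (hdata m hm), ?_⟩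
  simp

/-- **Class currency ⟹ divisibility currency (single datum).**  On the crux's frame, for a square-free product `n` of Zhang–Kolyvagin primes of
index `≥ L` (`L ≥ 1`) and ONE datum `e`: `addOrderOf c_L(e) = 2^L ⟹ P(n) ∉ 2E(K[n])`.  [cite: McCallumLMS1991, §4 Cor. 4.5] -/
theorem not_two_dvd_derivedPoint_of_addOrderOf_kolyvaginClass_two_pow (hK : IsImaginaryQuadratic K) (hodd : Odd (NumberField.discr K))
    (h3 : NumberField.discr K ≠ -3) (hHe : SatisfiesHeegnerHypothesis (W.conductorNorm ℤ) K) (hρ2 : W.HasSurjectiveModNGaloisRep 2)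
    (Dt : ModularForms.ModularParametrizationData W (W.conductorNorm ℤ)) (β : ℤ) (ι : K →+* ℂ) {L : ℕ} (hL1 : 1 ≤ L)
    {n : ℕ} (hn : Squarefree n)
    (hnK : ∀ q ∈ n.primeFactors, Zhang2014.IsKolyvaginPrime (W.conductorNorm ℤ) W K 2 q ∧ L ≤ Zhang2014.kolyvaginIndex W 2 q)
    (e : KolyvaginHeegnerData Dt β ι n) (he : addOrderOf (e.kolyvaginClass Nat.prime_two L) = 2 ^ L) :
    ¬ ∃ Q : (W.baseChange (ringClassField K ι n)).toAffine.Point, (2 : ℤ) • Q = e.derivedPoint := by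
  have hsurj1 : W.HasSurjectiveModNGaloisRep ((2 : ℤ) ^ 1) := by simpa using hρ2
  obtain ⟨fam, hfam⟩ := exists_family_eq_of_isKolyvaginPrime W hK hHe Dt β ι hn (fun q hq ↦ (hnK q hq).1) e
  rintro ⟨Q, hQ⟩
  have h2 : ((2 ^ (L - 1) : ℕ) : ℤ) • (fam n dvd_rfl).kolyvaginClass Nat.prime_two L = 0 :=
    (PlusDescent.pow_zsmul_kolyvaginClass_two_eq_zero_iff hK hodd h3 hHe hsurj1 hn hnK fam (j := L - 1) (by omega)).mpr
      ⟨Q, by rw [hfam, show L - (L - 1) = 1 by omega]; exact_mod_cast hQ⟩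
  rw [hfam] at h2
  have hne : ¬ 2 ^ (L - 1) • e.kolyvaginClass Nat.prime_two L = 0 := by
    rw [← addOrderOf_dvd_iff_nsmul_eq_zero, he, Nat.pow_dvd_pow_iff_le_right']
    omega
  exact hne (by rw [← natCast_zsmul]; exact_mod_cast h2)

/-- **Divisibility currency ⟹ class currency (single datum).**  On the crux's frame, for a square-free product `n` of Zhang–Kolyvagin primes of
index `≥ M` (`M ≥ 1`) and ONE datum `e`: `P(n) ∉ 2E(K[n]) ⟹ addOrderOf c_M(e) = 2^M`.  [cite: McCallumLMS1991, §4 Cor. 4.5] -/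
theorem addOrderOf_kolyvaginClass_two_eq_pow_of_not_two_dvd_single (hK : IsImaginaryQuadratic K) (hodd : Odd (NumberField.discr K))
    (h3 : NumberField.discr K ≠ -3) (hHe : SatisfiesHeegnerHypothesis (W.conductorNorm ℤ) K) (hρ2 : W.HasSurjectiveModNGaloisRep 2)
    (Dt : ModularForms.ModularParametrizationData W (W.conductorNorm ℤ)) (β : ℤ) (ι : K →+* ℂ) {M : ℕ} (hM1 : 1 ≤ M)
    {n : ℕ} (hn : Squarefree n)
    (hnK : ∀ q ∈ n.primeFactors, Zhang2014.IsKolyvaginPrime (W.conductorNorm ℤ) W K 2 q ∧ M ≤ Zhang2014.kolyvaginIndex W 2 q)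
    (e : KolyvaginHeegnerData Dt β ι n) (hprim : ¬ ∃ Q : (W.baseChange (ringClassField K ι n)).toAffine.Point, (2 : ℤ) • Q = e.derivedPoint) :
    addOrderOf (e.kolyvaginClass Nat.prime_two M) = 2 ^ M := by
  have hsurj1 : W.HasSurjectiveModNGaloisRep ((2 : ℤ) ^ 1) := by simpa using hρ2
  obtain ⟨fam, hfam⟩ := exists_family_eq_of_isKolyvaginPrime W hK hHe Dt β ι hn (fun q hq ↦ (hnK q hq).1) e
  have h := PlusDescent.addOrderOf_kolyvaginClass_two_eq_pow_of_not_two_dvd hK hodd h3 hHe hsurj1 hn hM1 hnK fam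
    (by rw [hfam]; exact hprim)
  rwa [hfam] at h

/-- **Single-datum level conversion (McCallum Cor. 4.5 at `2`, both ways).**  On the crux's frame, for a square-free product `n` of Zhang–Kolyvagin primes
of index `≥ L` (`L ≥ 2`) and ONE datum `e` at `n`: `addOrderOf c₂(e) = 4 ⟹ addOrderOf c_L(e) = 2^L` (both say `P(n) ∉ 2E(K[n])`).  [cite: McCallumLMS1991, §4 Cor. 4.5; §5 Prop. 5.2 (proof, first line)] -/
theorem addOrderOf_kolyvaginClass_two_pow_eq_of_four (hK : IsImaginaryQuadratic K) (hodd : Odd (NumberField.discr K))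
    (h3 : NumberField.discr K ≠ -3) (hHe : SatisfiesHeegnerHypothesis (W.conductorNorm ℤ) K) (hρ2 : W.HasSurjectiveModNGaloisRep 2)
    (Dt : ModularForms.ModularParametrizationData W (W.conductorNorm ℤ)) (β : ℤ) (ι : K →+* ℂ) {L : ℕ} (hL2 : 2 ≤ L)
    {n : ℕ} (hn : Squarefree n)
    (hnK : ∀ q ∈ n.primeFactors, Zhang2014.IsKolyvaginPrime (W.conductorNorm ℤ) W K 2 q ∧ L ≤ Zhang2014.kolyvaginIndex W 2 q)
    (e : KolyvaginHeegnerData Dt β ι n) (he : addOrderOf (e.kolyvaginClass Nat.prime_two 2) = 2 ^ 2) :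
    addOrderOf (e.kolyvaginClass Nat.prime_two L) = 2 ^ L :=
  have hnK2 : ∀ q ∈ n.primeFactors, Zhang2014.IsKolyvaginPrime (W.conductorNorm ℤ) W K 2 q ∧ 2 ≤ Zhang2014.kolyvaginIndex W 2 q :=
    fun q hq ↦ ⟨(hnK q hq).1, hL2.trans (hnK q hq).2⟩
  addOrderOf_kolyvaginClass_two_eq_pow_of_not_two_dvd_single W hK hodd h3 hHe hρ2 Dt β ι (by omega) hn hnK e
    (not_two_dvd_derivedPoint_of_addOrderOf_kolyvaginClass_two_pow W hK hodd h3 hHe hρ2 Dt β ι (L := 2) (by norm_num) hn hnK2 e he)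

/-- **THE BOTTOM RUNG in the socket currency of `exists_kolyvaginMinima`** (`addOrderOf c_L = 2^L` on an all-deep product, EITHER witness parity).
[cite: McCallumLMS1991, §5 proof of Prop. 5.2, p. 285] [cite: Kolyvagin1991MathAnn, Thm. 2.2] -/
theorem exists_deep_primitive_of_gross_witness_pow (hQ2 : KolyvaginRelationAtTwo) (hcm : ¬ W.HasCM) (hΔ : W.Δ < 0)
    (hT : Odd W.tamagawaProduct) (hρ : ∀ m : ℕ, W.HasSurjectiveModNGaloisRep (2 ^ m : ℕ))
    (hK : IsImaginaryQuadratic K) (hodd : Odd (NumberField.discr K)) (h3 : NumberField.discr K ≠ -3)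
    (hHe : SatisfiesHeegnerHypothesis (W.conductorNorm ℤ) K) (hns : ¬ IsSquare ((NumberField.discr K : ℚ) * -|W.Δ|))
    (Dt : ModularForms.ModularParametrizationData W (W.conductorNorm ℤ)) (β : ℤ) (ι : K →+* ℂ) {L : ℕ} (hL2 : 2 ≤ L)
    (hNPh : ∀ z : galH1Torsion (W.baseChange K) ((2 ^ L : ℕ) : ℤ),
      (∀ ρ' ∈ torsionFixing (W.baseChange K) ((2 ^ L : ℕ) : ℤ), h1Eval (W.baseChange K) ((2 ^ L : ℕ) : ℤ) z ρ' = 0) →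
      (∀ w : HeightOneSpectrum (𝓞 K), ((2 * W.conductorNorm ℤ : ℕ) : 𝓞 K) ∈ w.asIdeal →
        z ∈ selmerLocalKer (W.baseChange K) (w.adicCompletion K) ((2 ^ L : ℕ) : ℤ)) → z = 0)
    (hTr : ∀ (n' : ℕ) (d' : KolyvaginHeegnerData Dt β ι n') (Z : galoisCohomology (W.torsionGaloisModule ((2 ^ 2 : ℕ) : ℤ)) 1),
      Squarefree n' →
      (∀ q ∈ n'.primeFactors, Zhang2014.IsKolyvaginPrime (W.conductorNorm ℤ) W K 2 q ∧ 2 ≤ Zhang2014.kolyvaginIndex W 2 q ∧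
        FrobEqFrobInfty W K (2 ^ 2) q) →
      resTorsion W K ((2 ^ 2 : ℕ) : ℤ) Z = d'.kolyvaginClass Nat.prime_two 2 →
      ∀ (v : HeightOneSpectrum (𝓞 ℚ)) (ℓ : ℕ), ℓ ∈ n'.primeFactors → (ℓ : 𝓞 ℚ) ∈ v.asIdeal →
        L ≤ Zhang2014.kolyvaginIndex W 2 ℓ → FrobEqFrobInfty W K (2 ^ L) ℓ →
        ∀ 𝔓 ∈ v.primesAbove, ∀ F c₀ : absoluteGaloisGroup ℚ, IsArithFrobAt (𝓞 ℚ) F 𝔓 →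
          IsComplexConjugation (Rat.castHom ℝ) c₀ → (∀ P : geomTorsion W ((2 ^ 2 : ℕ) : ℤ), F • P = c₀ • P) →
          ∃ P₁ : geomTorsion W ((2 ^ 2 : ℕ) : ℤ), h1Eval W _ ((2 : ℕ) • Z) F = F • P₁ - P₁)
    {n₀ : ℕ} (hn₀ : Squarefree n₀)
    (hn₀K : ∀ q ∈ n₀.primeFactors, Zhang2014.IsKolyvaginPrime (W.conductorNorm ℤ) W K 2 q ∧ 2 ≤ Zhang2014.kolyvaginIndex W 2 q ∧
      FrobEqFrobInfty W K (2 ^ 2) q)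
    (e₀ : KolyvaginHeegnerData Dt β ι n₀) (he₀ : addOrderOf (e₀.kolyvaginClass Nat.prime_two 2) = 2 ^ 2) :
    ∃ (n : ℕ) (e : KolyvaginHeegnerData Dt β ι n), Squarefree n ∧
      (n.primeFactors.card = n₀.primeFactors.card ∨ n.primeFactors.card = n₀.primeFactors.card + 1) ∧
      (∀ q ∈ n.primeFactors, Zhang2014.IsKolyvaginPrime (W.conductorNorm ℤ) W K 2 q ∧ L ≤ Zhang2014.kolyvaginIndex W 2 q) ∧
      addOrderOf (e.kolyvaginClass Nat.prime_two L) = 2 ^ L := by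
  have hρ2 : W.HasSurjectiveModNGaloisRep 2 := by simpa using hρ 1
  obtain ⟨n, e, hn, hcard, hK', he⟩ := exists_deep_primitive_of_gross_witness' W hQ2 hcm hΔ hT hρ hK hodd h3 hHe hns Dt β ι hL2 hNPh hTr hn₀
    hn₀K e₀ he₀
  have hK'' : ∀ q ∈ n.primeFactors, Zhang2014.IsKolyvaginPrime (W.conductorNorm ℤ) W K 2 q ∧ L ≤ Zhang2014.kolyvaginIndex W 2 q :=
    fun q hq ↦ ⟨(hK' q hq).1, (hK' q hq).2.1⟩
  exact ⟨n, e, hn, hcard, hK'', addOrderOf_kolyvaginClass_two_pow_eq_of_four W hK hodd h3 hHe hρ2 Dt β ι hL2 hn hK'' e he⟩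

/-! ## §4 The bottom rung in Kolyvagin's divisibility currency (the crux's own `hPn` currency; (P52÷) of gk2-p2) -/

/-- **THE BOTTOM RUNG in the crux's own currency** (`P(n) ∉ 2E(K[n])` in, `P(n) ∉ 2E(K[n])` out; either witness parity): on L's frame with Q2,
from a square-free product `n₀` of LEVEL-4 GROSS–Kolyvagin primes (Zhang–Kolyvagin, index `≥ 2`, `Frob = Frob_∞` on `K(E[4])`) carrying a datum
with `P(n₀) ∉ 2E(K[n₀])`, there is a square-free `n` with `ω(n) ∈ {ω(n₀), ω(n₀)+1}`, ALL primes Zhang–Kolyvagin of index `≥ L`, and a datum with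
`P(n) ∉ 2E(K[n])` — the `r = R` clause of (P52÷) (`2^{0+1} ∤ P_d(n)` at a deep level), modulo (NPh_L^{2N}), the (V44)-socket `hTr`, Q2.
[cite: McCallumLMS1991, §5 Prop. 5.2 and its proof, p. 285] [cite: Kolyvagin1991MathAnn, Thm. 2.2] -/
theorem exists_deep_notTwoDvd_of_gross_witness (hQ2 : KolyvaginRelationAtTwo) (hcm : ¬ W.HasCM) (hΔ : W.Δ < 0)
    (hT : Odd W.tamagawaProduct) (hρ : ∀ m : ℕ, W.HasSurjectiveModNGaloisRep (2 ^ m : ℕ))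
    (hK : IsImaginaryQuadratic K) (hodd : Odd (NumberField.discr K)) (h3 : NumberField.discr K ≠ -3)
    (hHe : SatisfiesHeegnerHypothesis (W.conductorNorm ℤ) K) (hns : ¬ IsSquare ((NumberField.discr K : ℚ) * -|W.Δ|))
    (Dt : ModularForms.ModularParametrizationData W (W.conductorNorm ℤ)) (β : ℤ) (ι : K →+* ℂ) {L : ℕ} (hL2 : 2 ≤ L)
    (hNPh : ∀ z : galH1Torsion (W.baseChange K) ((2 ^ L : ℕ) : ℤ),
      (∀ ρ' ∈ torsionFixing (W.baseChange K) ((2 ^ L : ℕ) : ℤ), h1Eval (W.baseChange K) ((2 ^ L : ℕ) : ℤ) z ρ' = 0) →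
      (∀ w : HeightOneSpectrum (𝓞 K), ((2 * W.conductorNorm ℤ : ℕ) : 𝓞 K) ∈ w.asIdeal →
        z ∈ selmerLocalKer (W.baseChange K) (w.adicCompletion K) ((2 ^ L : ℕ) : ℤ)) → z = 0)
    (hTr : ∀ (n' : ℕ) (d' : KolyvaginHeegnerData Dt β ι n') (Z : galoisCohomology (W.torsionGaloisModule ((2 ^ 2 : ℕ) : ℤ)) 1),
      Squarefree n' →
      (∀ q ∈ n'.primeFactors, Zhang2014.IsKolyvaginPrime (W.conductorNorm ℤ) W K 2 q ∧ 2 ≤ Zhang2014.kolyvaginIndex W 2 q ∧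
        FrobEqFrobInfty W K (2 ^ 2) q) →
      resTorsion W K ((2 ^ 2 : ℕ) : ℤ) Z = d'.kolyvaginClass Nat.prime_two 2 →
      ∀ (v : HeightOneSpectrum (𝓞 ℚ)) (ℓ : ℕ), ℓ ∈ n'.primeFactors → (ℓ : 𝓞 ℚ) ∈ v.asIdeal →
        L ≤ Zhang2014.kolyvaginIndex W 2 ℓ → FrobEqFrobInfty W K (2 ^ L) ℓ →
        ∀ 𝔓 ∈ v.primesAbove, ∀ F c₀ : absoluteGaloisGroup ℚ, IsArithFrobAt (𝓞 ℚ) F 𝔓 →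
          IsComplexConjugation (Rat.castHom ℝ) c₀ → (∀ P : geomTorsion W ((2 ^ 2 : ℕ) : ℤ), F • P = c₀ • P) →
          ∃ P₁ : geomTorsion W ((2 ^ 2 : ℕ) : ℤ), h1Eval W _ ((2 : ℕ) • Z) F = F • P₁ - P₁)
    {n₀ : ℕ} (hn₀ : Squarefree n₀)
    (hn₀K : ∀ q ∈ n₀.primeFactors, Zhang2014.IsKolyvaginPrime (W.conductorNorm ℤ) W K 2 q ∧ 2 ≤ Zhang2014.kolyvaginIndex W 2 q ∧
      FrobEqFrobInfty W K (2 ^ 2) q)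
    (e₀ : KolyvaginHeegnerData Dt β ι n₀)
    (he₀ : ¬ ∃ Q : (W.baseChange (ringClassField K ι n₀)).toAffine.Point, (2 : ℤ) • Q = e₀.derivedPoint) :
    ∃ (n : ℕ) (e : KolyvaginHeegnerData Dt β ι n), Squarefree n ∧
      (n.primeFactors.card = n₀.primeFactors.card ∨ n.primeFactors.card = n₀.primeFactors.card + 1) ∧
      (∀ q ∈ n.primeFactors, Zhang2014.IsKolyvaginPrime (W.conductorNorm ℤ) W K 2 q ∧ L ≤ Zhang2014.kolyvaginIndex W 2 q) ∧
      ¬ ∃ Q : (W.baseChange (ringClassField K ι n)).toAffine.Point, (2 : ℤ) • Q = e.derivedPoint := by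
  have hρ2 : W.HasSurjectiveModNGaloisRep 2 := by simpa using hρ 1
  have he₀' : addOrderOf (e₀.kolyvaginClass Nat.prime_two 2) = 2 ^ 2 :=
    addOrderOf_kolyvaginClass_two_eq_pow_of_not_two_dvd_single W hK hodd h3 hHe hρ2 Dt β ι (M := 2) (by norm_num) hn₀
      (fun q hq ↦ ⟨(hn₀K q hq).1, (hn₀K q hq).2.1⟩) e₀ he₀
  obtain ⟨n, e, hn, hcard, hK', he⟩ := exists_deep_primitive_of_gross_witness_pow W hQ2 hcm hΔ hT hρ hK hodd h3 hHe hns Dt β ι hL2 hNPh hTr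
    hn₀ hn₀K e₀ he₀'
  exact ⟨n, e, hn, hcard, hK',
    not_two_dvd_derivedPoint_of_addOrderOf_kolyvaginClass_two_pow W hK hodd h3 hHe hρ2 Dt β ι (by omega) hn hK' e he⟩

end Summit.BirchSwinnertonDyer.BirchSwinnertonDyer.Theorems.GenusExact.RelaxedCount

end
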